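import Summits.HodgeConjecture.HodgeConjecture.Theses.HolomorphicityRate
import Literature.Geometry.Kaehler.NearlyHolomorphicCycleSupport
import Literature.Geometry.Riemannian.RiemannianMetricExists
import Literature.AlgebraicGeometry.HodgeTheory.HodgeModelConnected
import Literature.AlgebraicGeometry.HodgeTheory.LefschetzOneOneHolds
import Literature.AlgebraicTopology.SingularHomology.CohomologyClopenPieces
import Summits.HodgeConjecture.HodgeConjecture.Theorems.HolomorphicityRateRateGapExistsHolomorphicCycleSupport
import HarnessLib

/-!
# Route `HolomorphicityRate`, crux `RateGap` (R1): the crux follows from the Hodge conjecture at or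
# below the middle dimension — cancellation on the ray

Crux item `stmt-HodgeConjecture-10762` (`HolomorphicityRate.RateGap`, "Hodge ⟹ holomorphicity rate
`> p`") asks, for `X` smooth projective of dimension `n`, `p ≤ n`, a Hodge model `A` and a rational
class `c` with `A^* c` of type `(p,p)`, for a smooth metric `g`, `m ≥ 1`, a rational algebraic class
`hp`, a budget `a_k ≤ C kᵖ`, `δ > 0` and `C'` such that for infinitely many `k` the ray class
`m • c + a_k • hp` dies off a nearly holomorphic cycle support of codimension `p` and defect
`≤ C' k^{-(p+δ)}` (the predicate `Literature.Geometry.Kaehler.IsNearlyHolomorphicCycleSupport`,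
inlined in the item).

This file records, as helpers towards the crux (`--supports`), the lead prover's structural finding
that the crux is implied by — and, through the tree, reduces exactly to — the Hodge conjecture in
codimensions `2 ≤ p ≤ n/2`:

* `rateGap_conclusion_of_eq_zero` — the conclusion for `p = 0` outright (`S = X^an`, empty
  complement; same construction as the landed `universalRateOne_of_eq_zero`).
* `mem_algebraicClasses_of_hodgeBelowMiddle` — **reduction of the Hodge conjecture to codimensions
  `2 ≤ p ≤ n/2`**: granted algebraicity of rational `(p,p)`-classes for `2 ≤ p`, `2p ≤ n`, it holds in
  every codimension `0 < p ≤ n`, by the tree's Lefschetz `(1,1)` theorem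
  (`lefschetzOneOne_rational_holds`), top degree (`mem_algebraicClasses_of_degree_top`) and hard
  Lefschetz (`HardLefschetzNFold.mem_algebraicClasses_of_lt_holds`, Kerr–Pearlstein 2011 §3.1).
* `rateGap_of_hodgeBelowMiddle` — **the crux from the Hodge conjecture at or below the middle**, by
  CANCELLATION on the ray: the item leaves `hp` free among rational algebraic classes, so once `c` is
  algebraic take `hp := -c`, `m := 1`, `a_k := min k 1 ≤ kᵖ`; the ray class vanishes for every
  `k ≥ 1`, its pull-back dies everywhere, and the support clause is met by ANY holomorphic cycle
  support of codimension `p` in `X^an`, which exists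
  (`stub_existsHolomorphicCycleSupport`, file `HolomorphicityRateRateGapExistsHolomorphicCycleSupport`:
  a connected component of a level of the transverse flag of hyperplane sections read on `X^an`).
* `rateGap_of_hodgeConjecture` — in particular `HodgeConjecture → RateGap` (the summit statement
  implies the crux; with the route's deciding theorem `closes : RateGap → SuperThresholdRigidity → … →
  HodgeConjecture` the crux is pinned between the two).

Consequence for the route (recorded in the crux's census): as filed, R1 carries no content beyond the
Hodge conjecture plus elementary complex geometry — the intended "rate" mechanism (asymptotically
holomorphic carriers with decaying `(0,2)`-curvature) is not forced by the statement, because the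
algebraic summand `hp` may absorb `-c`. Pinning `hp` to (a multiple of) `h^p` would restore it.

## References

* P. Deligne, *The Hodge conjecture*, Clay problem description (2000), §1.
* C. Voisin, *Hodge Theory and Complex Algebraic Geometry I* (2002), Thm. 6.25, Thm. 11.30.
* M. Kerr, G. Pearlstein, *An exponential history of functions with logarithmic growth* (2011), §3.1.
-/

noncomputable section

open scoped Manifold ContDiff Topology
open Set Filter

-- `Summit.HodgeConjecture.HodgeConjecture.Theorems` is the mandated namespace (single-conjunct summit:
-- Sub = Summit), which `linter.dupNamespace` flags on every declaration; the lakefile turns the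
-- linter off tree-wide (weak option), restated here so stand-alone elaboration is warning-free too.
set_option linter.dupNamespace false

namespace Summit.HodgeConjecture.HodgeConjecture.Theorems

open Literature.AlgebraicGeometry.HodgeTheory Literature.AlgebraicGeometry.Motives
  Literature.AlgebraicTopology.SingularHomology Literature.Geometry.Kaehler

/-- **The crux's conclusion in codimension `p = 0`** (no algebraicity needed): `S = X^an` (connected,
`HodgeModel.connectedSpace_carrier`; every point regular of real codimension `0`, no equations),
`Sg = ∅`, `m = 1`, `hp = 0`, `a = 0`, `δ = 1`, `C' = 0`; the complement of `S` is empty, so every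
class dies on it (`isZero_singularCohomology_of_isEmpty`). Same construction as the landed
`universalRateOne_of_eq_zero`. [folklore] -/
theorem rateGap_conclusion_of_eq_zero (n p : ℕ) (X : Literature.AlgebraicGeometry.Motives.SchemeOver ℂ)
    (hX : Literature.AlgebraicGeometry.Motives.IsSmoothProjective n X) (hp0 : p = 0)
    (A : Literature.AlgebraicGeometry.HodgeTheory.HodgeModel n X)
    (c : Literature.AlgebraicGeometry.HodgeTheory.complexBetti X (2 * p)) :
    ∃ (g : Bundle.ContMDiffRiemannianMetric 𝓘(ℝ, A.model) ((⊤ : ℕ∞) : WithTop ℕ∞) A.model (fun x : A.carrier => TangentSpace 𝓘(ℝ, A.model) x)) (m : ℕ) (hp : Literature.AlgebraicGeometry.HodgeTheory.complexBetti X (2 * p)) (C : ℝ) (a : ℕ → ℕ) (δ C' : ℝ), 0 < m ∧ Literature.AlgebraicGeometry.HodgeTheory.IsRationalClass hp ∧ hp ∈ Literature.AlgebraicGeometry.HodgeTheory.algebraicClasses X p ∧ (∀ k, (a k : ℝ) ≤ C * (k : ℝ) ^ p) ∧ 0 < δ ∧ ∃ᶠ k : ℕ in Filter.atTop, ∃ S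 Sg : Set A.carrier, (IsClosed S ∧ IsClosed Sg ∧ Sg ⊆ S ∧ IsConnected (S \ Sg) ∧ (∀ x ∈ Sg, Literature.Geometry.Kaehler.IsAnalyticSetAt 𝓘(ℂ, A.model) S x) ∧ (∃ T : Set A.carrier, Sg ⊆ T ∧ (Literature.Geometry.Kaehler.IsAnalyticSet 𝓘(ℂ, A.model) T ∧ ∀ x ∈ Literature.Geometry.Kaehler.regularLocus 𝓘(ℂ, A.model) T, ∀ q : ℕ, Literature.Geometry.Kaehler.IsRegularPointOfCodim 𝓘(ℂ, A.model) T q x → p + 1 ≤ q)) ∧ (∀ x ∈ S \ Sg, ∃ U : Set A.carrier, IsOpen U ∧ x ∈ U ∧ ∃ f : A.carrier → (Fin (2 * p) → ℝ), ContMDiffOn 𝓘(ℝ, A.model) 𝓘(ℝ, Fin (2 * p) → ℝ) 1 f U ∧ S ∩ U = U ∩ f ⁻¹' {0} ∧ Function.Surjective (mfderiv 𝓘(ℝ, A.model) 𝓘(ℝ, Fin (2 * p) → ℝ) f x) ∧ ∀ v : TangentSpace 𝓘(ℝ, A.model) x, mfderiv 𝓘(ℝ, A.model) 𝓘(ℝ,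 Fin (2 * p) → ℝ) f x v = 0 → ∃ w : TangentSpace 𝓘(ℝ, A.model) x, mfderiv 𝓘(ℝ, A.model) 𝓘(ℝ, Fin (2 * p) → ℝ) f x w = 0 ∧ g.inner x (Literature.Geometry.Kaehler.tangentJ A.model x v - w) (Literature.Geometry.Kaehler.tangentJ A.model x v - w) ≤ (C' * (k : ℝ) ^ (-((p : ℝ) + δ))) ^ 2 * g.inner x v v)) ∧ Literature.AlgebraicTopology.SingularHomology.singularCohomology.map ℂ ℂ (⟨Subtype.val, continuous_subtype_val⟩ : C({x : A.carrier // x ∉ S}, A.carrier)) (2 * p) (A.pullback (2 * p) (((m : ℂ) • c + ((a k : ℕ) : ℂ) • hp))) = 0 := by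
  subst hp0
  haveI : ConnectedSpace A.carrier := A.connectedSpace_carrier hX
  obtain ⟨g⟩ := Literature.Geometry.Riemannian.nonempty_contMDiffRiemannianMetric
    (I := 𝓘(ℝ, A.model)) (M := A.carrier)
  refine ⟨g, 1, 0, 0, fun _ => 0, 1, 0, one_pos, IsRationalClass.zero, Submodule.zero_mem _,
    fun k => by simp, one_pos, Filter.Eventually.frequently (Filter.Eventually.of_forall fun k => ⟨Set.univ, ∅, ?_, ?_⟩)⟩
  · refine ⟨isClosed_univ, isClosed_empty, Set.empty_subset _, ?_, fun x hx => hx.elim,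
      ⟨∅, Set.empty_subset _, isAnalyticSet_empty, fun x hx =>
        ((regularLocus_subset (I := 𝓘(ℂ, A.model)) (∅ : Set A.carrier)) hx).elim⟩, ?_⟩
    · rw [Set.sdiff_empty]
      exact isConnected_univ
    · intro x _
      refine ⟨Set.univ, isOpen_univ, Set.mem_univ x, fun _ => 0, contMDiffOn_const, ?_, ?_, ?_⟩
      · ext y
        simp
      · intro y
        refine ⟨0, ?_⟩
        rw [map_zero]
        exact funext fun i => absurd i.2 (by omega)
      · intro v _
        refine ⟨Literature.Geometry.Kaehler.tangentJ A.model x v, ?_, ?_⟩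
        · exact funext fun i => absurd i.2 (by omega)
        · rw [sub_self, map_zero]
          exact mul_nonneg (sq_nonneg _) (riemannianMetric_inner_self_nonneg g.toRiemannianMetric x v)
  · -- the complement of `S = univ` is empty: no cohomology
    haveI : IsEmpty {x : A.carrier // x ∉ (Set.univ : Set A.carrier)} :=
      ⟨fun x => x.2 (Set.mem_univ _)⟩
    haveI := ModuleCat.subsingleton_of_isZero
      (isZero_singularCohomology_of_isEmpty (R := ℂ)
        (Y := {x : A.carrier // x ∉ (Set.univ : Set A.carrier)}) (2 * 0))
    exact Subsingleton.elim _ _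

/-- **Algebraicity of rational `(p,p)`-classes in every positive codimension, from the Hodge conjecture at
or below the middle.** Granted algebraicity of rational `(p,p)`-classes for `2 ≤ p`, `2p ≤ n` (`hH`), a rational class of type `(p,p)` in a Hodge model with
`0 < p ≤ n` is algebraic: `p = 1` is the rational Lefschetz `(1,1)` theorem
(`lefschetzOneOne_rational_holds`, Voisin I Thm. 11.30); `p = n` is the top degree
(`mem_algebraicClasses_of_degree_top`); `2 ≤ p ≤ n/2` is `hH`; and for `n < 2p < 2n` hard Lefschetz
(`HardLefschetzNFold.mem_algebraicClasses_of_lt_holds`: `L^{2p-n} : H^{2(n-p)} ≅ H^{2p}` maps rational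
`(n-p,n-p)`-classes onto rational `(p,p)`-classes and preserves algebraicity) reduces to codimension
`n - p`, which is `1` (Lefschetz) or in the range of `hH`. [cite: VoisinHodgeI2002, Thm. 6.25 and Thm. 11.30]
[cite: KerrPearlstein2011, §3.1] -/
theorem mem_algebraicClasses_of_hodgeBelowMiddle
    (hH : ∀ (n p : ℕ) (X : Literature.AlgebraicGeometry.Motives.SchemeOver ℂ), Literature.AlgebraicGeometry.Motives.IsSmoothProjective n X → 2 ≤ p → 2 * p ≤ n → ∀ (A : Literature.AlgebraicGeometry.HodgeTheory.HodgeModel n X) (c : Literature.AlgebraicGeometry.HodgeTheory.complexBetti X (2 * p)), Literature.AlgebraicGeometry.HodgeTheory.IsRationalClass c → A.pullback (2 * p) c ∈ A.hodgePQ (2 * p) p p → c ∈ Literature.AlgebraicGeometry.HodgeTheory.algebraicClasses X p)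
    {n p : ℕ} {X : Literature.AlgebraicGeometry.Motives.SchemeOver ℂ}
    (hX : Literature.AlgebraicGeometry.Motives.IsSmoothProjective n X) (hpn : p ≤ n) (hp0 : 0 < p)
    (A : Literature.AlgebraicGeometry.HodgeTheory.HodgeModel n X)
    (c : Literature.AlgebraicGeometry.HodgeTheory.complexBetti X (2 * p))
    (hc : Literature.AlgebraicGeometry.HodgeTheory.IsRationalClass c)
    (hpp : A.pullback (2 * p) c ∈ A.hodgePQ (2 * p) p p) :
    c ∈ Literature.AlgebraicGeometry.HodgeTheory.algebraicClasses X p := by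
  -- the two codimensions the tree settles directly
  by_cases h1 : p = 1
  · subst h1
    exact lefschetzOneOne_rational_holds hX c hc ⟨A, hpp⟩
  by_cases h2 : p = n
  · subst h2
    exact mem_algebraicClasses_of_degree_top hX hp0 c
  -- at or below the middle: the hypothesis
  by_cases h3 : 2 * p ≤ n
  · exact hH n p X hX (by omega) h3 A c hc hpp
  -- above the middle: hard Lefschetz down to codimension `l = n - p`, which is `1` or in the range of `hH`
  have key : ∀ l : ℕ, l = n - p → ∀ c' : Literature.AlgebraicGeometry.HodgeTheory.complexBetti X (2 * l),
      Literature.AlgebraicGeometry.HodgeTheory.IsRationalClass c' →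
        Literature.AlgebraicGeometry.HodgeTheory.IsOfHodgeType n X (2 * l) l l c' →
          c' ∈ Literature.AlgebraicGeometry.HodgeTheory.algebraicClasses X l := by
    intro l hl c' hc' hpq'
    by_cases h4 : l = 1
    · subst h4
      exact lefschetzOneOne_rational_holds hX c' hc' hpq'
    · obtain ⟨A', hA'⟩ := hpq'
      exact hH n l X hX (by omega) (by omega) A' c' hc' hA'
  exact HardLefschetzNFold.mem_algebraicClasses_of_lt_holds hX (by omega) (key (n - p) rfl) c hc ⟨A, hpp⟩

/-- **The crux `RateGap` from the Hodge conjecture at or below the middle (cancellation on the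
ray).** Granted algebraicity of rational `(p,p)`-classes for `2 ≤ p`, `2p ≤ n` (`hH`, the Hodge
conjecture in the range the tree does not prove), the route decl `HolomorphicityRate.RateGap` holds.
For `p = 0`: `rateGap_conclusion_of_eq_zero`. For `0 < p ≤ n`: `c` is algebraic
(`mem_algebraicClasses_of_hodgeBelowMiddle`: Lefschetz `(1,1)`, top degree, hard Lefschetz, and `hH`), so with any smooth metric `g`
(`nonempty_contMDiffRiemannianMetric`), `m := 1`, `hp := -c` (rational: `IsRationalClass.smul`;
algebraic: `Submodule.neg_mem`), `C := 1`, `a k := min k 1`, `δ := 1`, `C' := 0`, the ray class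
`1•c + (min k 1)•(-c)` vanishes for every `k ≥ 1`, its pull-back and restriction are `0` (`map_zero`),
and the support is any holomorphic cycle support of codimension `p` (`stub_existsHolomorphicCycleSupport`, defect `0·k^{-(p+1)}`), unfolded into the
route's inline predicate by `isNearlyHolomorphicCycleSupport_toRiemannianMetric_iff` (`Iff.rfl`).
[cite: Deligne2000, §1] -/
theorem rateGap_of_hodgeBelowMiddle
    (hH : ∀ (n p : ℕ) (X : Literature.AlgebraicGeometry.Motives.SchemeOver ℂ), Literature.AlgebraicGeometry.Motives.IsSmoothProjective n X → 2 ≤ p → 2 * p ≤ n → ∀ (A : Literature.AlgebraicGeometry.HodgeTheory.HodgeModel n X) (c : Literature.AlgebraicGeometry.HodgeTheory.complexBetti X (2 * p)), Literature.AlgebraicGeometry.HodgeTheory.IsRationalClass c → A.pullback (2 * p) c ∈ A.hodgePQ (2 * p) p p → c ∈ Literature.AlgebraicGeometry.HodgeTheory.algebraicClasses X p) :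
    Summit.HodgeConjecture.HodgeConjecture.Theses.HolomorphicityRate.RateGap := by
  intro n p X hX hpn A c hc hpp
  rcases Nat.eq_zero_or_pos p with hp0 | hp0
  · exact rateGap_conclusion_of_eq_zero n p X hX hp0 A c
  have halg : c ∈ Literature.AlgebraicGeometry.HodgeTheory.algebraicClasses X p :=
    mem_algebraicClasses_of_hodgeBelowMiddle hH hX hpn hp0 A c hc hpp
  obtain ⟨g⟩ := Literature.Geometry.Riemannian.nonempty_contMDiffRiemannianMetric
    (I := 𝓘(ℝ, A.model)) (M := A.carrier)
  have hrat : Literature.AlgebraicGeometry.HodgeTheory.IsRationalClass (-c) := by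
    simpa using hc.smul (-1)
  refine ⟨g, 1, -c, 1, fun k => min k 1, 1, 0, one_pos, hrat, Submodule.neg_mem _ halg, ?_, one_pos, ?_⟩
  · -- the budget `a_k = min k 1 ≤ 1 · k^p`
    intro k
    show ((min k 1 : ℕ) : ℝ) ≤ 1 * (k : ℝ) ^ p
    rcases Nat.eq_zero_or_pos k with hk | hk
    · subst hk
      simp
    · rw [min_eq_right hk, Nat.cast_one, one_mul]
      exact one_le_pow₀ (by exact_mod_cast hk)
  · -- for every `k ≥ 1`: a holomorphic cycle support of codimension `p` and the vanishing ray class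
    refine Filter.Eventually.frequently ((Filter.eventually_ge_atTop 1).mono fun k hk => ?_)
    obtain ⟨S, hS⟩ := stub_existsHolomorphicCycleSupport n p X hX hpn hp0 A g.toRiemannianMetric ((0 : ℝ) * (k : ℝ) ^ (-((p : ℝ) + 1)))
    refine ⟨S, ∅, (Literature.Geometry.Kaehler.isNearlyHolomorphicCycleSupport_toRiemannianMetric_iff g).1 hS, ?_⟩
    have h0 : (((1 : ℕ) : ℂ) • c + ((min k 1 : ℕ) : ℂ) • (-c)) = 0 := by
      rw [min_eq_right hk]
      simp
    rw [h0, map_zero, map_zero]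

/-- **The Hodge conjecture implies the crux `RateGap`** (the summit statement `_root_.HodgeConjecture`
feeds `rateGap_of_hodgeBelowMiddle`; with the route's deciding theorem
`HolomorphicityRate.closes : RateGap → SuperThresholdRigidity → AnalyticSupportAlgebraic →
HodgeModelsExist → HodgeConjecture` the crux sits between the two). [cite: Deligne2000, §1] -/
theorem rateGap_of_hodgeConjecture : _root_.HodgeConjecture → Summit.HodgeConjecture.HodgeConjecture.Theses.HolomorphicityRate.RateGap :=
  fun hHC => rateGap_of_hodgeBelowMiddle fun _ p _ hX _ _ A c hc hpp => (hHC hX).2 p c hc ⟨A, hpp⟩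

end Summit.HodgeConjecture.HodgeConjecture.Theorems

end
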